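/-
Copyright (c) 2026 the pub-hodgecm-mathlib formalisation cell (harness21).  Prover seat hodgecm-mathlib-F0P3a-p02 (g16): road «S3-ram» (LEAD F0P3a-plan (g12); architect
A-p16 (g31) 23:04:38Z deal (4) «(a2)(C-fin) CONIC CHARACTER SUM», scope (iii) only per ref5 (g4) R-273 and F0P3a-p01 (g16) 23:06:35Z), organ A′ (ii) (a2) part (C-fin)(iii), FILE A; 2026-09-01.
-/
import Literature.NumberTheory.Rogawski1990.DepthZeroKappaTransferTypeOneRamifiedRootTwists   -- ★ p847132 F0P3a-p01 (g16): `card_filter_mul_sq_eq`, `card_rootNull`, `signedSum_card_rootNull_twists`, `sum_card_rootNull_twists` (chart `x_α = 1`, twists `(ε^i u₀, ε^j u₁, ε^{i+j} u₂)`)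
import Literature.Combinatorics.Designs.PaleyConstruction                                       -- ★ `Paley.sum_quadraticChar_mul_quadraticChar_add` (Jacobsthal `Σ_b χ(b)χ(b+c) = −1`), `Paley.sum_quadraticChar_sq`
import HarnessLib

/-!
# The depth-zero κ-transfer at a tame-ramified place, type (1): the ROOT CLASS SUM `J_c(d) = Σ_{v iso} χ(c·Q_d(v))` is TWIST-INVARIANT
# (organ A′ (ii)(a2), part (C-fin)(iii), FILE A — finite-field algebra: eliminations and the three sign rules)

Topic `NumberTheory/Rogawski1990`; namespace `Literature.NumberTheory.Rogawski1990`.  THEOREMS ONLY (no definition, no instance, no notation, no named fact, no `sorry`);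
kernel lane `--supports stmt-HodgeConjecture-24833`.  Cell `pub/hodgecm-mathlib`, crux H413; road «S3-ram» (Literature seeding, count-neutral), P-1-ram skeleton organ A′ (ii)
(architect A-p16 (g31) deal (4) 2026-09-01T23:04:38Z), deal (a2) part (C): the COMPANION of ★ p847132 `DepthZeroKappaTransferTypeOneRamifiedRootTwists` (F0P3a-p01 (g16): the NULL
isotropic points of the four ramified type-(1) literals).  FILE A of two (FILE B `…RootClassSplit`: the counts and the κ-signed class split).  HONEST LABEL: HC_CM is proved only
modulo the 2 remaining named inputs (hLiu418 24832, h413 24833) until rung 0 closes; finite-field algebra only.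

THE MATHEMATICS.  `k` finite, `char k ≠ 2`, `χ = quadraticChar k`.  A literal is `d = (d₀, d₁, d₂) ∈ (k^×)³` (residual form `diag(d₀,d₁,d₂)` in the eigen-coordinates `(x_α, x_u, x_γ)`),
the root's leading form is `Q_d(v) = d₀A·v_α² + d₂C·v_γ²` (`A, C, A − C ≠ 0`), and the class of a non-null isotropic vector is `χ(c·Q_d(v))` for a fixed constant `c ≠ 0` (F0P3a-p01:
`c = −1`, ★ p847102).  At the level of VECTORS `v ∈ k³ = k × k × k` (each line counted `q − 1` times; `v = 0` contributes `0`):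
  `J_c(d) := Σ_{v ∈ k³, Σ dᵢvᵢ² = 0} χ(c·Q_d(v))` (`= #{class +} − #{class −}`, FILE B).
(§0) two character sums: `Σ_y χ(y² + a) = −1` (`a ≠ 0`; Jacobsthal ★ `Paley.sum_quadraticChar_mul_quadraticChar_add`) and **`Σ_{(x,y) ∈ k²} χ(ax² + by²) = 0`** (`a, b ≠ 0`).
(§1) ELIMINATION: counting the coordinate `v_u` over each `(v_α, v_γ)` (`#{y : d₁y² = −m} = χ(−d₁m) + 1`, ★ `card_filter_mul_sq_eq`) gives
`J_c(d) = Σ_{(x,z)} χ(cQ) + χ(−d₁)·Σ_{(x,z)} χ((d₀x² + d₂z²)·cQ(x,z)) = 0 + χ(−d₁)·S₁(d₀,d₂)` — so **`J_c(d₀, e·d₁, d₂) = χ(e)·J_c(d)`**; ON the conic `Q ≡ (A−C)d₀v_α² − Cd₁v_u²`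
(eliminate `v_γ`) and `Q ≡ −Ad₁v_u² + (C−A)d₂v_γ²` (eliminate `v_α`), so the same computation gives the sign rules in `d₂` and in `d₀`; hence **`J_c(e₀d₀, e₁d₁, e₂d₂) = χ(e₀e₁e₂)·J_c(d)`**
and the four TWISTS `d^{(b)} = (ε^{b_α}u₀, ε^{b_u}u₁, ε^{b_α+b_u}u₂)` (`χ(ε) = −1`) all have the SAME `J` (`χ(ε^{2b_α+2b_u}) = 1`; F0P3a-p01's «collar identity», `jinv.py`):
**`Σ_b κ_b·J_c(d^{(b)}) = 0`** (`κ_b = (−1)^{b_u}`) and `Σ_b J_c(d^{(b)}) = 4J_c(u)`.  (`J_c(u)` itself is an elliptic-curve character sum — no closed form is claimed or needed.)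

* §0 `sum_comp_sq_eq_sum_mul`, `sum_quadraticChar_sq_add`, `sum_quadraticChar_binaryForm`.
* §1 `sum_ite_iso_elim_mid ∕ _last ∕ _first` (eliminate one coordinate), `rootClassSum_eq_elim_mid ∕ _last ∕ _first` (the three one-coordinate formulas for `J_c`),
  `rootClassSum_scale_mid ∕ _last ∕ _first` (sign rules), **`rootClassSum_scale`** (`χ(e₀e₁e₂)`).
* §1b **`rootClassSum_twist`**, **`signedSum_rootClassSum_twists`** (`= 0`), `sum_rootClassSum_twists` (`= 4J`).

## References
* [Rogawski1990] J. D. Rogawski, *Automorphic Representations of Unitary Groups in Three Variables*, Ann. of Math. Stud. 123 (1990), §4.9 Prop. 4.9.1 (a)(b) p. 55; §12.2.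
* [LabesseLanglands1979] J.-P. Labesse, R. P. Langlands, *L-indistinguishability for SL(2)*, Canad. J. Math. 31 (1979), §5 (κ-signs over the four classes).
* [IrelandRosen1990] K. Ireland, M. Rosen, *A Classical Introduction to Modern Number Theory*, GTM 84, Ch. 8 §1–§2 (quadratic character sums, Jacobsthal sums).
-/

set_option autoImplicit false

namespace Literature.NumberTheory.Rogawski1990

open Finset

variable {k : Type*} [Field k] [Fintype k] [DecidableEq k]

/-! ## §0 Two character sums: `Σ_y χ(y² + a) = −1` and `Σ_{x,y} χ(ax² + by²) = 0` -/

/-- `Σ_y f(y²) = Σ_a (χ(a) + 1)·f(a)` — each `a` has `χ(a) + 1` square roots (★ `card_filter_mul_sq_eq`). [cite: IrelandRosen1990, Ch. 8 §1] -/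
theorem sum_comp_sq_eq_sum_mul (hk : ringChar k ≠ 2) (f : k → ℤ) : ∑ y : k, f (y ^ 2) = ∑ a : k, (quadraticChar k a + 1) * f a := by
  have h1 : ∀ y : k, f (y ^ 2) = ∑ a : k, if y ^ 2 = a then f a else 0 := fun y => by
    rw [Finset.sum_ite_eq]; simp
  simp_rw [h1]
  rw [Finset.sum_comm]
  refine Finset.sum_congr rfl fun a _ => ?_
  rw [← Finset.sum_filter, Finset.sum_const, nsmul_eq_mul]
  congr 1
  have h := card_filter_mul_sq_eq hk (one_ne_zero (α := k)) a
  simp only [one_mul] at h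
  exact h

/-- **`Σ_y χ(y² + a) = −1` for `a ≠ 0`** (`= Σ_b (χ b + 1)χ(b + a) = ` Jacobsthal `−1` (★ `Paley.sum_quadraticChar_mul_quadraticChar_add`) `+ Σ_b χ(b + a) = 0`).
[cite: IrelandRosen1990, Ch. 8 §2] -/
theorem sum_quadraticChar_sq_add (hk : ringChar k ≠ 2) {a : k} (ha : a ≠ 0) : ∑ y : k, quadraticChar k (y ^ 2 + a) = -1 := by
  rw [sum_comp_sq_eq_sum_mul hk (fun b => quadraticChar k (b + a))]
  simp_rw [add_mul, one_mul, Finset.sum_add_distrib]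
  rw [Literature.Combinatorics.Designs.Paley.sum_quadraticChar_mul_quadraticChar_add hk ha]
  have hshift : ∑ b : k, quadraticChar k (b + a) = ∑ b : k, quadraticChar k b :=
    Fintype.sum_equiv (Equiv.addRight a) _ _ fun _ => rfl
  rw [hshift, quadraticChar_sum_zero hk, add_zero]

/-- **`Σ_{(x,y) ∈ k²} χ(ax² + by²) = 0` for `a, b ≠ 0`**: the column `x = 0` gives `χ(b)(q−1)`, each of the `q − 1` others `χ(b)·Σ_y χ(y² + ax²∕b) = −χ(b)`.
[cite: IrelandRosen1990, Ch. 8 §2] -/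
theorem sum_quadraticChar_binaryForm (hk : ringChar k ≠ 2) {a b : k} (ha : a ≠ 0) (hb : b ≠ 0) :
    ∑ p : k × k, quadraticChar k (a * p.1 ^ 2 + b * p.2 ^ 2) = 0 := by
  rw [Fintype.sum_prod_type]
  have hinner : ∀ x : k, ∑ y : k, quadraticChar k (a * x ^ 2 + b * y ^ 2) =
      quadraticChar k b * (if x = 0 then (Fintype.card k : ℤ) - 1 else -1) := by
    intro x
    have hrw : ∀ y : k, a * x ^ 2 + b * y ^ 2 = b * (y ^ 2 + a * x ^ 2 / b) := fun y => by field_simp; ring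
    simp_rw [hrw, map_mul, ← Finset.mul_sum]
    congr 1
    split_ifs with hx
    · rw [hx, zero_pow two_ne_zero, mul_zero, zero_div]
      simp_rw [add_zero, map_pow]
      exact Literature.Combinatorics.Designs.Paley.sum_quadraticChar_sq
    · exact sum_quadraticChar_sq_add hk (div_ne_zero (mul_ne_zero ha (pow_ne_zero _ hx)) hb)
  simp_rw [hinner, ← Finset.mul_sum]
  rw [Finset.sum_ite, Finset.sum_const, Finset.sum_const, Finset.filter_eq', Finset.filter_ne']
  simp only [Finset.mem_univ, if_true, Finset.card_singleton, one_smul, Finset.card_erase_of_mem, Finset.card_univ, smul_neg, nsmul_eq_mul,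
    mul_one]
  rw [Nat.cast_sub Fintype.card_pos, Nat.cast_one]
  ring

/-! ## §1 Elimination of one coordinate, the three sign rules, twist invariance -/

section Elimination

variable {d₀ d₁ d₂ A C c : k}

/-- **Eliminating `x_u`**: `Σ_{v : iso} g(v_α, v_γ) = Σ_{(x,z)} (χ(−d₁(d₀x² + d₂z²)) + 1)·g(x,z)` (`d₁ ≠ 0`; `#{y : d₁y² = −m} = χ(−d₁m) + 1`, ★ `card_filter_mul_sq_eq`).
[cite: IrelandRosen1990, Ch. 8 §1] -/
theorem sum_ite_iso_elim_mid (hk : ringChar k ≠ 2) (hd₁ : d₁ ≠ 0) (g : k → k → ℤ) :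
    (∑ v : k × k × k, if d₀ * v.1 ^ 2 + d₁ * v.2.1 ^ 2 + d₂ * v.2.2 ^ 2 = 0 then g v.1 v.2.2 else 0) =
      ∑ p : k × k, (quadraticChar k (-(d₁ * (d₀ * p.1 ^ 2 + d₂ * p.2 ^ 2))) + 1) * g p.1 p.2 := by
  simp only [Fintype.sum_prod_type]
  refine Finset.sum_congr rfl fun x _ => ?_
  rw [Finset.sum_comm]
  refine Finset.sum_congr rfl fun z _ => ?_
  have hiff : ∀ y : k, d₀ * x ^ 2 + d₁ * y ^ 2 + d₂ * z ^ 2 = 0 ↔ (d₁ * y) ^ 2 = -(d₁ * (d₀ * x ^ 2 + d₂ * z ^ 2)) := by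
    intro y
    constructor
    · intro h
      linear_combination d₁ * h
    · intro h
      have h' : d₁ * (d₀ * x ^ 2 + d₁ * y ^ 2 + d₂ * z ^ 2) = 0 := by linear_combination h
      rcases mul_eq_zero.1 h' with h1 | h1
      · exact absurd h1 hd₁
      · exact h1
  simp_rw [hiff]
  rw [← Finset.sum_filter, Finset.sum_const, nsmul_eq_mul, card_filter_mul_sq_eq hk hd₁]

/-- **Eliminating `x_γ`**: `Σ_{v : iso} g(v_α, v_u) = Σ_{(x,y)} (χ(−d₂(d₀x² + d₁y²)) + 1)·g(x,y)` (`d₂ ≠ 0`). [cite: IrelandRosen1990, Ch. 8 §1] -/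
theorem sum_ite_iso_elim_last (hk : ringChar k ≠ 2) (hd₂ : d₂ ≠ 0) (g : k → k → ℤ) :
    (∑ v : k × k × k, if d₀ * v.1 ^ 2 + d₁ * v.2.1 ^ 2 + d₂ * v.2.2 ^ 2 = 0 then g v.1 v.2.1 else 0) =
      ∑ p : k × k, (quadraticChar k (-(d₂ * (d₀ * p.1 ^ 2 + d₁ * p.2 ^ 2))) + 1) * g p.1 p.2 := by
  simp only [Fintype.sum_prod_type]
  refine Finset.sum_congr rfl fun x _ => Finset.sum_congr rfl fun y _ => ?_
  have hiff : ∀ z : k, d₀ * x ^ 2 + d₁ * y ^ 2 + d₂ * z ^ 2 = 0 ↔ (d₂ * z) ^ 2 = -(d₂ * (d₀ * x ^ 2 + d₁ * y ^ 2)) := by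
    intro z
    constructor
    · intro h
      linear_combination d₂ * h
    · intro h
      have h' : d₂ * (d₀ * x ^ 2 + d₁ * y ^ 2 + d₂ * z ^ 2) = 0 := by linear_combination h
      rcases mul_eq_zero.1 h' with h1 | h1
      · exact absurd h1 hd₂
      · exact h1
  simp_rw [hiff]
  rw [← Finset.sum_filter, Finset.sum_const, nsmul_eq_mul, card_filter_mul_sq_eq hk hd₂]

/-- **Eliminating `x_α`**: `Σ_{v : iso} g(v_u, v_γ) = Σ_{(y,z)} (χ(−d₀(d₁y² + d₂z²)) + 1)·g(y,z)` (`d₀ ≠ 0`). [cite: IrelandRosen1990, Ch. 8 §1] -/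
theorem sum_ite_iso_elim_first (hk : ringChar k ≠ 2) (hd₀ : d₀ ≠ 0) (g : k → k → ℤ) :
    (∑ v : k × k × k, if d₀ * v.1 ^ 2 + d₁ * v.2.1 ^ 2 + d₂ * v.2.2 ^ 2 = 0 then g v.2.1 v.2.2 else 0) =
      ∑ p : k × k, (quadraticChar k (-(d₀ * (d₁ * p.1 ^ 2 + d₂ * p.2 ^ 2))) + 1) * g p.1 p.2 := by
  simp only [Fintype.sum_prod_type]
  rw [Finset.sum_comm]
  refine Finset.sum_congr rfl fun y _ => ?_
  rw [Finset.sum_comm]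
  refine Finset.sum_congr rfl fun z _ => ?_
  have hiff : ∀ x : k, d₀ * x ^ 2 + d₁ * y ^ 2 + d₂ * z ^ 2 = 0 ↔ (d₀ * x) ^ 2 = -(d₀ * (d₁ * y ^ 2 + d₂ * z ^ 2)) := by
    intro x
    constructor
    · intro h
      linear_combination d₀ * h
    · intro h
      have h' : d₀ * (d₀ * x ^ 2 + d₁ * y ^ 2 + d₂ * z ^ 2) = 0 := by linear_combination h
      rcases mul_eq_zero.1 h' with h1 | h1
      · exact absurd h1 hd₀
      · exact h1
  simp_rw [hiff]
  rw [← Finset.sum_filter, Finset.sum_const, nsmul_eq_mul, card_filter_mul_sq_eq hk hd₀]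

/-- **`J_c(d)` by eliminating `x_u`: `J_c(d) = χ(−d₁)·Σ_{(x,z)} χ((d₀x² + d₂z²)·cQ(x,z))`** — the vanishing part is ★ `sum_quadraticChar_binaryForm`.
[cite: IrelandRosen1990, Ch. 8 §2] [cite: Rogawski1990, §4.9 Prop. 4.9.1 (b) p. 55] -/
theorem rootClassSum_eq_elim_mid (hk : ringChar k ≠ 2) (hd₀ : d₀ ≠ 0) (hd₁ : d₁ ≠ 0) (hd₂ : d₂ ≠ 0) (hA : A ≠ 0) (hC : C ≠ 0) (hc : c ≠ 0) :
    (∑ v : k × k × k, if d₀ * v.1 ^ 2 + d₁ * v.2.1 ^ 2 + d₂ * v.2.2 ^ 2 = 0 then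
        quadraticChar k (c * (d₀ * A * v.1 ^ 2 + d₂ * C * v.2.2 ^ 2)) else 0) =
      quadraticChar k (-d₁) * ∑ p : k × k, quadraticChar k ((d₀ * p.1 ^ 2 + d₂ * p.2 ^ 2) * (c * (d₀ * A * p.1 ^ 2 + d₂ * C * p.2 ^ 2))) := by
  rw [sum_ite_iso_elim_mid hk hd₁ (fun x z => quadraticChar k (c * (d₀ * A * x ^ 2 + d₂ * C * z ^ 2)))]
  simp_rw [add_mul, one_mul, Finset.sum_add_distrib]
  have h0 : ∑ p : k × k, quadraticChar k (c * (d₀ * A * p.1 ^ 2 + d₂ * C * p.2 ^ 2)) = 0 := by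
    have h := sum_quadraticChar_binaryForm hk (mul_ne_zero hc (mul_ne_zero hd₀ hA)) (mul_ne_zero hc (mul_ne_zero hd₂ hC))
    rw [← h]
    exact Finset.sum_congr rfl fun p _ => by congr 1; ring
  rw [h0, add_zero, Finset.mul_sum]
  refine Finset.sum_congr rfl fun p _ => ?_
  rw [← map_mul, ← map_mul]
  congr 1
  ring

/-- **`J_c(d)` by eliminating `x_γ`** (on the conic `Q ≡ (A−C)d₀x_α² − Cd₁x_u²`): `J_c(d) = χ(−d₂)·Σ_{(x,y)} χ((d₀x² + d₁y²)·c((A−C)d₀x² − Cd₁y²))` (`A ≠ C`).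
[cite: IrelandRosen1990, Ch. 8 §2] [cite: Rogawski1990, §4.9 Prop. 4.9.1 (b) p. 55] -/
theorem rootClassSum_eq_elim_last (hk : ringChar k ≠ 2) (hd₀ : d₀ ≠ 0) (hd₁ : d₁ ≠ 0) (hd₂ : d₂ ≠ 0) (hC : C ≠ 0) (hAC : A ≠ C) (hc : c ≠ 0) :
    (∑ v : k × k × k, if d₀ * v.1 ^ 2 + d₁ * v.2.1 ^ 2 + d₂ * v.2.2 ^ 2 = 0 then
        quadraticChar k (c * (d₀ * A * v.1 ^ 2 + d₂ * C * v.2.2 ^ 2)) else 0) =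
      quadraticChar k (-d₂) * ∑ p : k × k, quadraticChar k ((d₀ * p.1 ^ 2 + d₁ * p.2 ^ 2) * (c * ((A - C) * d₀ * p.1 ^ 2 - C * d₁ * p.2 ^ 2))) := by
  have hcongr : ∀ v : k × k × k, (if d₀ * v.1 ^ 2 + d₁ * v.2.1 ^ 2 + d₂ * v.2.2 ^ 2 = 0 then
        quadraticChar k (c * (d₀ * A * v.1 ^ 2 + d₂ * C * v.2.2 ^ 2)) else 0) =
      (if d₀ * v.1 ^ 2 + d₁ * v.2.1 ^ 2 + d₂ * v.2.2 ^ 2 = 0 then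
        quadraticChar k (c * ((A - C) * d₀ * v.1 ^ 2 - C * d₁ * v.2.1 ^ 2)) else 0) := by
    intro v
    split_ifs with h
    · congr 1
      linear_combination (c * C) * h
    · rfl
  simp_rw [hcongr]
  rw [sum_ite_iso_elim_last hk hd₂ (fun x y => quadraticChar k (c * ((A - C) * d₀ * x ^ 2 - C * d₁ * y ^ 2)))]
  simp_rw [add_mul, one_mul, Finset.sum_add_distrib]
  have h0 : ∑ p : k × k, quadraticChar k (c * ((A - C) * d₀ * p.1 ^ 2 - C * d₁ * p.2 ^ 2)) = 0 := by
    have h := sum_quadraticChar_binaryForm hk (mul_ne_zero hc (mul_ne_zero (sub_ne_zero.2 hAC) hd₀)) (neg_ne_zero.2 (mul_ne_zero hc (mul_ne_zero hC hd₁)))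
    rw [← h]
    exact Finset.sum_congr rfl fun p _ => by congr 1; ring
  rw [h0, add_zero, Finset.mul_sum]
  refine Finset.sum_congr rfl fun p _ => ?_
  rw [← map_mul, ← map_mul]
  congr 1
  ring

/-- **`J_c(d)` by eliminating `x_α`** (on the conic `Q ≡ −Ad₁x_u² + (C−A)d₂x_γ²`): `J_c(d) = χ(−d₀)·Σ_{(y,z)} χ((d₁y² + d₂z²)·c(−Ad₁y² + (C−A)d₂z²))` (`A ≠ C`).
[cite: IrelandRosen1990, Ch. 8 §2] [cite: Rogawski1990, §4.9 Prop. 4.9.1 (b) p. 55] -/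
theorem rootClassSum_eq_elim_first (hk : ringChar k ≠ 2) (hd₀ : d₀ ≠ 0) (hd₁ : d₁ ≠ 0) (hd₂ : d₂ ≠ 0) (hA : A ≠ 0) (hAC : A ≠ C) (hc : c ≠ 0) :
    (∑ v : k × k × k, if d₀ * v.1 ^ 2 + d₁ * v.2.1 ^ 2 + d₂ * v.2.2 ^ 2 = 0 then
        quadraticChar k (c * (d₀ * A * v.1 ^ 2 + d₂ * C * v.2.2 ^ 2)) else 0) =
      quadraticChar k (-d₀) * ∑ p : k × k, quadraticChar k ((d₁ * p.1 ^ 2 + d₂ * p.2 ^ 2) * (c * (-(A * d₁) * p.1 ^ 2 + (C - A) * d₂ * p.2 ^ 2))) := by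
  have hcongr : ∀ v : k × k × k, (if d₀ * v.1 ^ 2 + d₁ * v.2.1 ^ 2 + d₂ * v.2.2 ^ 2 = 0 then
        quadraticChar k (c * (d₀ * A * v.1 ^ 2 + d₂ * C * v.2.2 ^ 2)) else 0) =
      (if d₀ * v.1 ^ 2 + d₁ * v.2.1 ^ 2 + d₂ * v.2.2 ^ 2 = 0 then
        quadraticChar k (c * (-(A * d₁) * v.2.1 ^ 2 + (C - A) * d₂ * v.2.2 ^ 2)) else 0) := by
    intro v
    split_ifs with h
    · congr 1
      linear_combination (c * A) * h
    · rfl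
  simp_rw [hcongr]
  rw [sum_ite_iso_elim_first hk hd₀ (fun y z => quadraticChar k (c * (-(A * d₁) * y ^ 2 + (C - A) * d₂ * z ^ 2)))]
  simp_rw [add_mul, one_mul, Finset.sum_add_distrib]
  have h0 : ∑ p : k × k, quadraticChar k (c * (-(A * d₁) * p.1 ^ 2 + (C - A) * d₂ * p.2 ^ 2)) = 0 := by
    have h := sum_quadraticChar_binaryForm hk (mul_ne_zero hc (neg_ne_zero.2 (mul_ne_zero hA hd₁))) (mul_ne_zero hc (mul_ne_zero (sub_ne_zero.2 (Ne.symm hAC)) hd₂))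
    rw [← h]
    exact Finset.sum_congr rfl fun p _ => by congr 1; ring
  rw [h0, add_zero, Finset.mul_sum]
  refine Finset.sum_congr rfl fun p _ => ?_
  rw [← map_mul, ← map_mul]
  congr 1
  ring

/-- **Sign rule in `d₁`**: `J_c(d₀, e·d₁, d₂) = χ(e)·J_c(d₀, d₁, d₂)` (`e ≠ 0`). [cite: Rogawski1990, §4.9 Prop. 4.9.1 (b) p. 55] [cite: LabesseLanglands1979, §5] -/
theorem rootClassSum_scale_mid (hk : ringChar k ≠ 2) (hd₀ : d₀ ≠ 0) (hd₁ : d₁ ≠ 0) (hd₂ : d₂ ≠ 0) (hA : A ≠ 0) (hC : C ≠ 0) (hc : c ≠ 0) {e : k} (he : e ≠ 0) :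
    (∑ v : k × k × k, if d₀ * v.1 ^ 2 + e * d₁ * v.2.1 ^ 2 + d₂ * v.2.2 ^ 2 = 0 then
        quadraticChar k (c * (d₀ * A * v.1 ^ 2 + d₂ * C * v.2.2 ^ 2)) else 0) =
      quadraticChar k e * ∑ v : k × k × k, if d₀ * v.1 ^ 2 + d₁ * v.2.1 ^ 2 + d₂ * v.2.2 ^ 2 = 0 then
        quadraticChar k (c * (d₀ * A * v.1 ^ 2 + d₂ * C * v.2.2 ^ 2)) else 0 := by
  rw [rootClassSum_eq_elim_mid hk hd₀ (mul_ne_zero he hd₁) hd₂ hA hC hc, rootClassSum_eq_elim_mid hk hd₀ hd₁ hd₂ hA hC hc, ← mul_assoc, ← map_mul]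
  congr 2
  ring

/-- **Sign rule in `d₂`**: `J_c(d₀, d₁, e·d₂) = χ(e)·J_c(d₀, d₁, d₂)` (`e ≠ 0`, `A ≠ C`). [cite: Rogawski1990, §4.9 Prop. 4.9.1 (b) p. 55] [cite: LabesseLanglands1979, §5] -/
theorem rootClassSum_scale_last (hk : ringChar k ≠ 2) (hd₀ : d₀ ≠ 0) (hd₁ : d₁ ≠ 0) (hd₂ : d₂ ≠ 0) (hC : C ≠ 0) (hAC : A ≠ C) (hc : c ≠ 0) {e : k} (he : e ≠ 0) :
    (∑ v : k × k × k, if d₀ * v.1 ^ 2 + d₁ * v.2.1 ^ 2 + e * d₂ * v.2.2 ^ 2 = 0 then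
        quadraticChar k (c * (d₀ * A * v.1 ^ 2 + e * d₂ * C * v.2.2 ^ 2)) else 0) =
      quadraticChar k e * ∑ v : k × k × k, if d₀ * v.1 ^ 2 + d₁ * v.2.1 ^ 2 + d₂ * v.2.2 ^ 2 = 0 then
        quadraticChar k (c * (d₀ * A * v.1 ^ 2 + d₂ * C * v.2.2 ^ 2)) else 0 := by
  rw [rootClassSum_eq_elim_last hk hd₀ hd₁ (mul_ne_zero he hd₂) hC hAC hc, rootClassSum_eq_elim_last hk hd₀ hd₁ hd₂ hC hAC hc, ← mul_assoc, ← map_mul]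
  congr 2
  ring

/-- **Sign rule in `d₀`**: `J_c(e·d₀, d₁, d₂) = χ(e)·J_c(d₀, d₁, d₂)` (`e ≠ 0`, `A ≠ C`). [cite: Rogawski1990, §4.9 Prop. 4.9.1 (b) p. 55] [cite: LabesseLanglands1979, §5] -/
theorem rootClassSum_scale_first (hk : ringChar k ≠ 2) (hd₀ : d₀ ≠ 0) (hd₁ : d₁ ≠ 0) (hd₂ : d₂ ≠ 0) (hA : A ≠ 0) (hAC : A ≠ C) (hc : c ≠ 0) {e : k} (he : e ≠ 0) :
    (∑ v : k × k × k, if e * d₀ * v.1 ^ 2 + d₁ * v.2.1 ^ 2 + d₂ * v.2.2 ^ 2 = 0 then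
        quadraticChar k (c * (e * d₀ * A * v.1 ^ 2 + d₂ * C * v.2.2 ^ 2)) else 0) =
      quadraticChar k e * ∑ v : k × k × k, if d₀ * v.1 ^ 2 + d₁ * v.2.1 ^ 2 + d₂ * v.2.2 ^ 2 = 0 then
        quadraticChar k (c * (d₀ * A * v.1 ^ 2 + d₂ * C * v.2.2 ^ 2)) else 0 := by
  rw [rootClassSum_eq_elim_first hk (mul_ne_zero he hd₀) hd₁ hd₂ hA hAC hc, rootClassSum_eq_elim_first hk hd₀ hd₁ hd₂ hA hAC hc, ← mul_assoc, ← map_mul]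
  congr 2
  ring

/-- **THE THREE SIGN RULES TOGETHER: `J_c(e₀d₀, e₁d₁, e₂d₂) = χ(e₀e₁e₂)·J_c(d)`** (`eᵢ ≠ 0`; `A, C, A − C, c, dᵢ ≠ 0`).
[cite: Rogawski1990, §4.9 Prop. 4.9.1 (b) p. 55] [cite: LabesseLanglands1979, §5] -/
theorem rootClassSum_scale (hk : ringChar k ≠ 2) (hd₀ : d₀ ≠ 0) (hd₁ : d₁ ≠ 0) (hd₂ : d₂ ≠ 0) (hA : A ≠ 0) (hC : C ≠ 0) (hAC : A ≠ C) (hc : c ≠ 0)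
    {e₀ e₁ e₂ : k} (he₀ : e₀ ≠ 0) (he₁ : e₁ ≠ 0) (he₂ : e₂ ≠ 0) :
    (∑ v : k × k × k, if e₀ * d₀ * v.1 ^ 2 + e₁ * d₁ * v.2.1 ^ 2 + e₂ * d₂ * v.2.2 ^ 2 = 0 then
        quadraticChar k (c * (e₀ * d₀ * A * v.1 ^ 2 + e₂ * d₂ * C * v.2.2 ^ 2)) else 0) =
      quadraticChar k (e₀ * e₁ * e₂) * ∑ v : k × k × k, if d₀ * v.1 ^ 2 + d₁ * v.2.1 ^ 2 + d₂ * v.2.2 ^ 2 = 0 then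
        quadraticChar k (c * (d₀ * A * v.1 ^ 2 + d₂ * C * v.2.2 ^ 2)) else 0 := by
  rw [rootClassSum_scale_first hk hd₀ (mul_ne_zero he₁ hd₁) (mul_ne_zero he₂ hd₂) hA hAC hc he₀,
    rootClassSum_scale_mid hk hd₀ hd₁ (mul_ne_zero he₂ hd₂) hA hC hc he₁]
  have h3 : (∑ v : k × k × k, if d₀ * v.1 ^ 2 + d₁ * v.2.1 ^ 2 + e₂ * d₂ * v.2.2 ^ 2 = 0 then
        quadraticChar k (c * (d₀ * A * v.1 ^ 2 + e₂ * d₂ * C * v.2.2 ^ 2)) else 0) =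
      quadraticChar k e₂ * ∑ v : k × k × k, if d₀ * v.1 ^ 2 + d₁ * v.2.1 ^ 2 + d₂ * v.2.2 ^ 2 = 0 then
        quadraticChar k (c * (d₀ * A * v.1 ^ 2 + d₂ * C * v.2.2 ^ 2)) else 0 :=
    rootClassSum_scale_last hk hd₀ hd₁ hd₂ hC hAC hc he₂
  rw [h3, map_mul, map_mul]
  ring

end Elimination

/-! ## §1b The four twists `(ε^{b_α}u₀, ε^{b_u}u₁, ε^{b_α+b_u}u₂)`: `J` is twist-invariant, so its κ-signed sum vanishes -/

section Twists

variable {u₀ u₁ u₂ ε A C c : k}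

/-- **TWIST INVARIANCE: `J_c(ε^i u₀, ε^j u₁, ε^{i+j} u₂) = J_c(u₀, u₁, u₂)`** (`χ(ε^{2(i+j)}) = 1`; F0P3a-p01's «COLLAR IDENTITY» `jinv.py`).
[cite: Rogawski1990, §4.9 Prop. 4.9.1 (b) p. 55] [cite: LabesseLanglands1979, §5] -/
theorem rootClassSum_twist (hk : ringChar k ≠ 2) (hε : quadraticChar k ε = -1) (hu₀ : u₀ ≠ 0) (hu₁ : u₁ ≠ 0) (hu₂ : u₂ ≠ 0)
    (hA : A ≠ 0) (hC : C ≠ 0) (hAC : A ≠ C) (hc : c ≠ 0) (i j : ℕ) :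
    (∑ v : k × k × k, if ε ^ i * u₀ * v.1 ^ 2 + ε ^ j * u₁ * v.2.1 ^ 2 + ε ^ (i + j) * u₂ * v.2.2 ^ 2 = 0 then
        quadraticChar k (c * (ε ^ i * u₀ * A * v.1 ^ 2 + ε ^ (i + j) * u₂ * C * v.2.2 ^ 2)) else 0) =
      ∑ v : k × k × k, if u₀ * v.1 ^ 2 + u₁ * v.2.1 ^ 2 + u₂ * v.2.2 ^ 2 = 0 then
        quadraticChar k (c * (u₀ * A * v.1 ^ 2 + u₂ * C * v.2.2 ^ 2)) else 0 := by
  have hε0 : ε ≠ 0 := by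
    rintro rfl
    rw [MulChar.map_zero] at hε
    norm_num at hε
  rw [rootClassSum_scale hk hu₀ hu₁ hu₂ hA hC hAC hc (pow_ne_zero _ hε0) (pow_ne_zero _ hε0) (pow_ne_zero _ hε0)]
  have h1 : quadraticChar k (ε ^ i * ε ^ j * ε ^ (i + j)) = 1 := by
    rw [← pow_add, ← pow_add, show i + j + (i + j) = 2 * (i + j) by ring, pow_mul, map_pow, map_pow, hε]
    norm_num
  rw [h1, one_mul]

/-- **`Σ_b κ_b·J_c(d^{(b)}) = 0`** over the four twists `b ∈ {0,1}²`, `κ_b = (−1)^{b_u}` (twist invariance). [cite: LabesseLanglands1979, §5] [cite: Rogawski1990, §4.9 Prop. 4.9.1 (b) p. 55] -/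
theorem signedSum_rootClassSum_twists (hk : ringChar k ≠ 2) (hε : quadraticChar k ε = -1) (hu₀ : u₀ ≠ 0) (hu₁ : u₁ ≠ 0) (hu₂ : u₂ ≠ 0)
    (hA : A ≠ 0) (hC : C ≠ 0) (hAC : A ≠ C) (hc : c ≠ 0) :
    (∑ b : Fin 2 × Fin 2, (-1 : ℤ) ^ (b.2 : ℕ) *
      ∑ v : k × k × k, if ε ^ (b.1 : ℕ) * u₀ * v.1 ^ 2 + ε ^ (b.2 : ℕ) * u₁ * v.2.1 ^ 2 + ε ^ ((b.1 : ℕ) + b.2) * u₂ * v.2.2 ^ 2 = 0 then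
        quadraticChar k (c * (ε ^ (b.1 : ℕ) * u₀ * A * v.1 ^ 2 + ε ^ ((b.1 : ℕ) + b.2) * u₂ * C * v.2.2 ^ 2)) else 0) = 0 := by
  simp_rw [rootClassSum_twist hk hε hu₀ hu₁ hu₂ hA hC hAC hc]
  simp only [Fintype.sum_prod_type, Fin.sum_univ_two, Fin.val_zero, Fin.val_one, pow_zero, pow_one]
  ring

/-- **`Σ_b J_c(d^{(b)}) = 4·J_c(u)`**: the UNSIGNED class difference over the four literals is governed by ONE twist-invariant sum (an elliptic-curve character sum; no closed
form is claimed). [cite: LabesseLanglands1979, §5] [cite: Rogawski1990, §4.9 Prop. 4.9.1 (b) p. 55] -/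
theorem sum_rootClassSum_twists (hk : ringChar k ≠ 2) (hε : quadraticChar k ε = -1) (hu₀ : u₀ ≠ 0) (hu₁ : u₁ ≠ 0) (hu₂ : u₂ ≠ 0)
    (hA : A ≠ 0) (hC : C ≠ 0) (hAC : A ≠ C) (hc : c ≠ 0) :
    (∑ b : Fin 2 × Fin 2,
      ∑ v : k × k × k, if ε ^ (b.1 : ℕ) * u₀ * v.1 ^ 2 + ε ^ (b.2 : ℕ) * u₁ * v.2.1 ^ 2 + ε ^ ((b.1 : ℕ) + b.2) * u₂ * v.2.2 ^ 2 = 0 then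
        quadraticChar k (c * (ε ^ (b.1 : ℕ) * u₀ * A * v.1 ^ 2 + ε ^ ((b.1 : ℕ) + b.2) * u₂ * C * v.2.2 ^ 2)) else 0) =
      4 * ∑ v : k × k × k, if u₀ * v.1 ^ 2 + u₁ * v.2.1 ^ 2 + u₂ * v.2.2 ^ 2 = 0 then
        quadraticChar k (c * (u₀ * A * v.1 ^ 2 + u₂ * C * v.2.2 ^ 2)) else 0 := by
  simp_rw [rootClassSum_twist hk hε hu₀ hu₁ hu₂ hA hC hAC hc]
  simp only [Fintype.sum_prod_type, Fin.sum_univ_two]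
  ring

end Twists

end Literature.NumberTheory.Rogawski1990
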